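import Summits.HodgeConjecture.HodgeConjecture.Theses.SevenfoldWeilCensus
import Summits.HodgeConjecture.HodgeConjecture.Theses.RankFourFaces
import Summits.HodgeConjecture.HodgeConjecture.Theses.ConservativityLefschetz
import Summits.HodgeConjecture.HodgeConjecture.Theses.PadicSemiregularLift
import Summits.HodgeConjecture.HodgeConjecture.Theorems.AbelianComplement.Negative.RankFourFacesSummitEquivalence
import Literature.AlgebraicGeometry.Motives.AbelianVarietyProjectiveChart
import HarnessLib

/-!
# `AbelianComplement` (stmt-HodgeConjecture-15889): the BRIDGE decomposition, assembled

Routes `SevenfoldWeilCensus` (residual R2) and `RankFourFaces` (rank 9) of `HodgeConjecture` share the item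
`AbelianComplement` — the Hodge conjecture off the abelian locus — which is kernel-checked equivalent to the
summit (`Theorems.AbelianComplement.Negative.abelianComplement_iff_hodgeConjecture`, unconditional). Under the
ruling RESTATED IS A REDIRECT the item is decomposed; this helper file (it supports the item, it does not close
it) is the proved ASSEMBLY of the bridge decomposition onto two EXISTING items:

* piece 1 = item stmt-HodgeConjecture-1333, `Theses.PadicSemiregularLift.HodgeAbelianVarieties` — the Hodge
  conjecture for every complex abelian variety (the abelian milestone);
* piece 2 = item stmt-HodgeConjecture-10452, `Theses.ConservativityLefschetz.AbelianComplement` — the Hodge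
  conjecture granted the abelian case (the bridge off the abelian locus);
* `abelianComplement_of_items : piece 1 → piece 2 → SevenfoldWeilCensus.AbelianComplement` (and the
  RankFourFaces twin), `abelianComplement_iff_items : AbelianComplement ↔ piece 1 ∧ piece 2` (the split is exact).

The summit-level seam `piece 1 → piece 2 → HodgeConjecture` is modus ponens (its contrapositive is the landed
`HodgeAbelianVarieties.Negative.KillTransfer.not_of_not_hodgeConjecture_of_abelianComplement`). Per-piece
probes (`pieceᵢ → S`, `pieceᵢ → AbelianComplement` fail; BC7 clean) are recorded in
`Cruxes/AbelianComplement/BC2-PROBES-bridge.md`. Everything is proved; standard axioms only.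

References: P. Deligne, *The Hodge conjecture* (Clay, 2000), §1; Y. André, *Pour une théorie inconditionnelle
des motifs*, Publ. Math. IHÉS 83 (1996), §0.
-/

-- Summit.HodgeConjecture.HodgeConjecture.… repeats the summit name by the D-0017 layout (Sub = Summit).
set_option linter.dupNamespace false

namespace Summit.HodgeConjecture.HodgeConjecture.Theorems.AbelianComplement.BridgeSplit

open Summit.HodgeConjecture.HodgeConjecture.Theses
open Literature.AlgebraicGeometry.Motives Literature.AlgebraicGeometry.HodgeTheory

/-- **The glue of the bridge split**, concluding the SevenfoldWeilCensus decl of item 15889: feed the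
bridge (item 10452) with the abelian milestone (item 1333; the smooth-projective binder is discarded) and
restrict the summit statement to the non-abelian `X`. [cite: Deligne2000, §1] -/
theorem abelianComplement_of_items (h₁ : PadicSemiregularLift.HodgeAbelianVarieties)
    (h₂ : ConservativityLefschetz.AbelianComplement) : SevenfoldWeilCensus.AbelianComplement :=
  fun _ _ hX _ ↦ h₂ (fun A _ ↦ h₁ A) hX

/-- The same glue on the verbatim twin decl of route RankFourFaces. [cite: Deligne2000, §1] -/
theorem abelianComplementRFF_of_items (h₁ : PadicSemiregularLift.HodgeAbelianVarieties)
    (h₂ : ConservativityLefschetz.AbelianComplement) : RankFourFaces.AbelianComplement :=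
  fun _ _ hX _ ↦ h₂ (fun A _ ↦ h₁ A) hX

/-- The two route decls of item 15889 are one proposition. [folklore] -/
theorem sevenfold_iff_rankFourFaces :
    SevenfoldWeilCensus.AbelianComplement ↔ RankFourFaces.AbelianComplement := Iff.rfl

/-- **Exactness**: the item gives back both pieces (through the unconditional
`hodgeConjecture_of_abelianComplement` and `AbelianVariety.isSmoothProjective_holds`). [cite: Deligne2000, §1] -/
theorem items_of_abelianComplement (h : SevenfoldWeilCensus.AbelianComplement) :
    PadicSemiregularLift.HodgeAbelianVarieties ∧ ConservativityLefschetz.AbelianComplement :=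
  have H : _root_.HodgeConjecture :=
    AbelianComplement.Negative.hodgeConjecture_of_abelianComplement
      (show RankFourFaces.AbelianComplement from fun _ _ hX hA ↦ h hX hA)
  ⟨fun _ ↦ H AbelianVariety.isSmoothProjective_holds, fun _ ↦ H⟩

/-- `AbelianComplement ↔ piece 1 ∧ piece 2`. [cite: Deligne2000, §1] -/
theorem abelianComplement_iff_items :
    SevenfoldWeilCensus.AbelianComplement ↔
      PadicSemiregularLift.HodgeAbelianVarieties ∧ ConservativityLefschetz.AbelianComplement :=
  ⟨items_of_abelianComplement, fun h ↦ abelianComplement_of_items h.1 h.2⟩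

/-- The summit-level seam of the bridge: `piece 1 → piece 2 → HodgeConjecture` (modus ponens).
[cite: Deligne2000, §1] -/
theorem hodgeConjecture_of_items (h₁ : PadicSemiregularLift.HodgeAbelianVarieties)
    (h₂ : ConservativityLefschetz.AbelianComplement) : _root_.HodgeConjecture :=
  h₂ fun A _ ↦ h₁ A

/-- Informational converse `S → piece 1`. [folklore] -/
theorem hodgeAbelianVarieties_of_hodgeConjecture (H : _root_.HodgeConjecture) :
    PadicSemiregularLift.HodgeAbelianVarieties :=
  fun _ ↦ H AbelianVariety.isSmoothProjective_holds

/-- Informational converse `S → piece 2` (trivial). [folklore] -/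
theorem abelianToHodge_of_hodgeConjecture (H : _root_.HodgeConjecture) :
    ConservativityLefschetz.AbelianComplement := fun _ ↦ H

end Summit.HodgeConjecture.HodgeConjecture.Theorems.AbelianComplement.BridgeSplit
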